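import Mathlib
import Summits.ValiantsHypothesis.ValiantsHypothesis.Statement
import Summits.ValiantsHypothesis.ValiantsHypothesis.Cruxes.OrbitDimensionBound.Lines.NoMinorLadder

/-!
# `no_minor_covering` — ON-PATH CHECK `S → Rung` (forward rung g5, crux `FreeSubtorus.OrbitDimensionBound`)

The rung declaration handed to the kernel is the asymptotic shadow `NoMinor.NoMinorShadow` (the numeric rung
`NoMinorCovering` implies it: `noMinorShadow_of_noMinorCovering`).  `S → NoMinorShadow` is PROVED in the ladder
(`noMinorShadow_of_summit`: along any sequence of `T_Λ`-equivariant affine determinantal representations of `per_n`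
of sizes `m_n`, `dc(per_n) ≤ m_n ≤ m_n · 2^{r_n}`; a p-bounded `dc(per)` puts `per` in `VP`, i.e. `VP = VNP`), and
registered `@[aesop safe apply]`, so the kernel's on-path probe `intro h; aesop` closes — recorded
`s_implies_c: closed (intro h; aesop)`, `on_path: true` in `tribunal_kernel.json` of the filing seat.
The [nec]-trap is discharged by the witness file `no_minor_covering_special.lean` ((a): the floor member is the seed).
-/

set_option linter.dupNamespace false

namespace Summit.ValiantsHypothesis.ValiantsHypothesis.Cruxes.OrbitDimensionBound.NoMinor.OnPath

open Summit.ValiantsHypothesis.ValiantsHypothesis.Cruxes.OrbitDimensionBound.NoMinor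

/-- `S → Rung` by name. -/
theorem rung_of_summit (hS : _root_.ValiantsHypothesis) : NoMinorShadow := noMinorShadow_of_summit hS

/-- The kernel's probe shape. -/
example : _root_.ValiantsHypothesis → NoMinorShadow := by
  intro h
  aesop

/-- `S →` the shadow of EVERY member of the dial (incl. the top). -/
example (𝓐 : LatticeClass) (hS : _root_.ValiantsHypothesis) : ShadowOn 𝓐 := shadowOn_of_summit 𝓐 hS

/-- And the numeric rung feeds the shadow. -/
example (h : NoMinorCovering) : NoMinorShadow := noMinorShadow_of_noMinorCovering h

end Summit.ValiantsHypothesis.ValiantsHypothesis.Cruxes.OrbitDimensionBound.NoMinor.OnPath
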